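import Literature.RingTheory.LocalCohomology.CechLowDegrees
import Literature.RingTheory.LocalCohomology.CechTorsion
import Literature.RingTheory.LocalCohomology.CechDepth
import Mathlib.LinearAlgebra.Span.Basic
import Mathlib.Tactic.LinearCombination
import HarnessLib

/-!
# Lifting unit Čech `1`-cocycles through a square-zero extension (SGA 2 XI 1.1)

Topic `Literature/RingTheory/LocalCohomology`. Let `φ : A' → A` be a surjective homomorphism
of `R`-algebras whose kernel `N` has square zero, and `y_1, …, y_s ∈ R`. A *unit `1`-cocycle*
on `Č(y; A)` is a family of units `u_{ij} ∈ A_{y_i y_j}` (indexed by all ordered pairs, the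
full ordered Čech complex of `CechComplex.lean`) with `u_{ij} u_{jk} = u_{ik}` in
`A_{y_i y_j y_k}` — the transition functions of an invertible sheaf on `⋃ D(y_i)` trivial on
each `D(y_i)`. **Theorem** (`exists_unit_cocycle_lift`): if every `2`-cocycle of the module
Čech complex `Č(y; N)` is a coboundary, every unit `1`-cocycle over `A` lifts to a unit
`1`-cocycle over `A'`. This is the module-theoretic content of SGA 2 XI (1.1)–Prop. 1.1: the
exact sequence `0 → P_n → 𝒪*_{X_{n+1}} → 𝒪*_{X_n} → 1` (`u(x) = 1 + x`) gives
`H¹(𝒪*_{X_{n+1}}) → H¹(𝒪*_{X_n}) → H²(P_n)`, so invertible sheaves lift when `H²(Y, P_n) = 0`.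
Proof: lift `u` to units `w` (`isUnit_of_locMap_isUnit`, kernel nilpotent); the defect
`c = w₀₁ w₁₂ w₀₂⁻¹ = 1 + z` has `z` with values in `N`, and the multiplicative `2`-cocycle
identity of `c` becomes the additive one for `z` because `N² = 0` (`dC_two_defect_eq_zero`);
write `z = d b` and put `u' = w (1 - b)`.

Everything is proved; no named facts.

## References

* [Grothendieck1968SGA2] A. Grothendieck, SGA 2, Exp. XI, (1.1) and Prop. 1.1
  (arXiv:math/0511279, p. 68).
* [StacksProject] The Stacks Project, Tag 01FG (ordered Čech complex), Tag 0C6Q (deforming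
  invertible modules).
-/

noncomputable section

open CategoryTheory

universe u

namespace Literature.RingTheory.LocalCohomology

variable {R : Type u} [CommRing R] {s : ℕ} {y : Fin s → R}
variable {A A' : Type u} [CommRing A] [Algebra R A] [CommRing A'] [Algebra R A'] (φ : A' →ₐ[R] A)

/-! ## Calculus of elements of `A'_{y_t}` that die in `A_{y_t}` -/

section KerCalculus

/-- Elements of `A'_{y_t}` dying in `A_{y_t}` come from the kernel of `φ` (localisation is
exact). [folklore] -/
theorem exists_locMap_subtype_eq_of_locMap_eq_zero {n : ℕ} (t : Fin n → Fin s)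
    {X : CechLoc y A' t} (hX : locMap y φ.toLinearMap t X = 0) :
    ∃ Z : CechLoc y (LinearMap.ker φ.toLinearMap) t,
      locMap y (LinearMap.ker φ.toLinearMap).subtype t Z = X :=
  ((locMap_exact y (LinearMap.ker φ.toLinearMap).subtype φ.toLinearMap
    (LinearMap.exact_subtype_ker_map φ.toLinearMap) t) X).mp hX

/-- Elements coming from the kernel of `φ` die in `A_{y_t}`. [folklore] -/
theorem locMap_locMap_subtype {n : ℕ} (t : Fin n → Fin s)
    (Z : CechLoc y (LinearMap.ker φ.toLinearMap) t) :
    locMap y φ.toLinearMap t (locMap y (LinearMap.ker φ.toLinearMap).subtype t Z) = 0 :=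
  ((locMap_exact y (LinearMap.ker φ.toLinearMap).subtype φ.toLinearMap
    (LinearMap.exact_subtype_ker_map φ.toLinearMap) t) _).mpr ⟨Z, rfl⟩

/-- **Square zero**: if `(ker φ)² = 0` then the product of two elements of `A'_{y_t}` dying in
`A_{y_t}` is zero. [folklore] -/
theorem mul_eq_zero_of_locMap_eq_zero (hsq : ∀ a b : A', φ a = 0 → φ b = 0 → a * b = 0)
    {n : ℕ} (t : Fin n → Fin s) {X X' : CechLoc y A' t} (hX : locMap y φ.toLinearMap t X = 0)
    (hX' : locMap y φ.toLinearMap t X' = 0) : X * X' = 0 := by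
  obtain ⟨Z, rfl⟩ := exists_locMap_subtype_eq_of_locMap_eq_zero φ t hX
  obtain ⟨Z', rfl⟩ := exists_locMap_subtype_eq_of_locMap_eq_zero φ t hX'
  induction Z using LocalizedModule.induction_on with | h m p => ?_
  induction Z' using LocalizedModule.induction_on with | h m' p' => ?_
  rw [locMap_mk, locMap_mk, LocalizedModule.mk_mul_mk, Submodule.subtype_apply,
    Submodule.subtype_apply, hsq _ _ m.2 m'.2, LocalizedModule.zero_mk]

/-- Elements dying in `A_{y_t}` form an ideal: closure under left multiplication. [folklore] -/
theorem locMap_mul_eq_zero_of_locMap_eq_zero {n : ℕ} (t : Fin n → Fin s) (X : CechLoc y A' t)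
    {Z : CechLoc y A' t} (hZ : locMap y φ.toLinearMap t Z = 0) :
    locMap y φ.toLinearMap t (X * Z) = 0 := by
  rw [locMap_mul, hZ, mul_zero]

/-- Restriction preserves dying in `A`. [folklore] -/
theorem locMap_res_eq_zero {n n' : ℕ} (t : Fin n → Fin s) (θ : Fin n' → Fin n)
    {Z : CechLoc y A' (t ∘ θ)} (hZ : locMap y φ.toLinearMap (t ∘ θ) Z = 0) :
    locMap y φ.toLinearMap t (res y A' t θ Z) = 0 := by
  have h := congrArg (fun f => f Z) (res_comp_locMap y φ.toLinearMap t θ)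
  simp only [LinearMap.coe_comp, Function.comp_apply] at h
  rw [← h, hZ, map_zero]

/-- Restriction commutes with `φ`, elementwise. [folklore] -/
theorem locMap_res {n n' : ℕ} (t : Fin n → Fin s) (θ : Fin n' → Fin n) (X : CechLoc y A' (t ∘ θ)) :
    locMap y φ.toLinearMap t (res y A' t θ X) = res y A t θ (locMap y φ.toLinearMap (t ∘ θ) X) := by
  have h := congrArg (fun f => f X) (res_comp_locMap y φ.toLinearMap t θ)
  simpa using h.symm

/-- **Units lift through a square-zero extension**: an element of `A'_{y_t}` whose image in
`A_{y_t}` is a unit is a unit. [folklore] -/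
theorem isUnit_of_locMap_isUnit (hφ : Function.Surjective φ)
    (hsq : ∀ a b : A', φ a = 0 → φ b = 0 → a * b = 0) {n : ℕ} (t : Fin n → Fin s)
    {X : CechLoc y A' t} (hX : IsUnit (locMap y φ.toLinearMap t X)) : IsUnit X := by
  obtain ⟨V, hV⟩ := locMap_surjective y φ.toLinearMap hφ t (↑(hX.unit⁻¹) : CechLoc y A t)
  -- `X V = 1 + n` with `n` dying in `A`
  set nn := X * V - 1 with hnn
  have hn : locMap y φ.toLinearMap t nn = 0 := by
    rw [hnn, map_sub, locMap_mul, hV, IsUnit.mul_val_inv, locMap_one, sub_self]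
  have hn2 : nn * nn = 0 := mul_eq_zero_of_locMap_eq_zero φ hsq t hn hn
  refine IsUnit.of_mul_eq_one (V * (1 - nn)) ?_
  have h1 : X * V = 1 + nn := by rw [hnn]; ring
  calc X * (V * (1 - nn)) = (X * V) * (1 - nn) := by ring
    _ = 1 - nn * nn := by rw [h1]; ring
    _ = 1 := by rw [hn2, sub_zero]

/-- `1 - n` is a unit when `n` dies in `A` (square zero). [folklore] -/
theorem isUnit_one_sub_of_locMap_eq_zero (hsq : ∀ a b : A', φ a = 0 → φ b = 0 → a * b = 0)
    {n : ℕ} (t : Fin n → Fin s) {Z : CechLoc y A' t} (hZ : locMap y φ.toLinearMap t Z = 0) :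
    IsUnit (1 - Z) :=
  IsUnit.of_mul_eq_one (1 + Z) (by
    have h := mul_eq_zero_of_locMap_eq_zero φ hsq t hZ hZ
    calc (1 - Z) * (1 + Z) = 1 - Z * Z := by ring
      _ = 1 := by rw [h, sub_zero])

end KerCalculus

/-! ## Pure algebra: the two identities behind the lifting -/

section Algebra

variable {K : Type u} [CommRing K]

/-- **The multiplicative `2`-cocycle identity becomes additive modulo a square-zero ideal.** With
units `W₀₂, W₀₃, W₁₃` and defects `Z_i` defined by `(1 + Z₀) W₁₃ = W₁₂ W₂₃`,
`(1 + Z₁) W₀₃ = W₀₂ W₂₃`, `(1 + Z₂) W₀₃ = W₀₁ W₁₃`, `(1 + Z₃) W₀₂ = W₀₁ W₁₂` and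
`Z₀ Z₂ = Z₁ Z₃ = 0`, one has `Z₀ - Z₁ + Z₂ - Z₃ = 0`. [folklore] -/
theorem alt_sum_eq_zero_of_defects {W₀₁ W₀₂ W₀₃ W₁₂ W₁₃ W₂₃ Z₀ Z₁ Z₂ Z₃ : K}
    (h₀₂ : IsUnit W₀₂) (h₀₃ : IsUnit W₀₃) (h₁₃ : IsUnit W₁₃)
    (e₀ : (1 + Z₀) * W₁₃ = W₁₂ * W₂₃) (e₁ : (1 + Z₁) * W₀₃ = W₀₂ * W₂₃)
    (e₂ : (1 + Z₂) * W₀₃ = W₀₁ * W₁₃) (e₃ : (1 + Z₃) * W₀₂ = W₀₁ * W₁₂)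
    (hz₀₂ : Z₀ * Z₂ = 0) (hz₁₃ : Z₁ * Z₃ = 0) : Z₀ - Z₁ + Z₂ - Z₃ = 0 := by
  -- `(1 + Z₀ + Z₂) W₀₃ W₁₃ = W₀₁ W₁₂ W₂₃ W₁₃`
  have hA : (1 + Z₀ + Z₂) * W₀₃ * W₁₃ = W₀₁ * W₁₂ * W₂₃ * W₁₃ := by
    have : (1 + Z₀ + Z₂) * W₀₃ * W₁₃ = ((1 + Z₀) * W₁₃) * ((1 + Z₂) * W₀₃) - Z₀ * Z₂ * W₀₃ * W₁₃ := by
      ring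
    rw [this, e₀, e₂, hz₀₂]; ring
  have hA' : (1 + Z₀ + Z₂) * W₀₃ = W₀₁ * W₁₂ * W₂₃ := (h₁₃.mul_left_inj).mp hA
  -- `(1 + Z₁ + Z₃) W₀₃ W₀₂ = W₀₁ W₁₂ W₂₃ W₀₂`
  have hB : (1 + Z₁ + Z₃) * W₀₃ * W₀₂ = W₀₁ * W₁₂ * W₂₃ * W₀₂ := by
    have : (1 + Z₁ + Z₃) * W₀₃ * W₀₂ = ((1 + Z₁) * W₀₃) * ((1 + Z₃) * W₀₂) - Z₁ * Z₃ * W₀₃ * W₀₂ := by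
      ring
    rw [this, e₁, e₃, hz₁₃]; ring
  have hB' : (1 + Z₁ + Z₃) * W₀₃ = W₀₁ * W₁₂ * W₂₃ := (h₀₂.mul_left_inj).mp hB
  have hC : (1 + Z₀ + Z₂) = (1 + Z₁ + Z₃) := (h₀₃.mul_left_inj).mp (hA'.trans hB'.symm)
  linear_combination hC

/-- **The corrected lift is a cocycle**: with `(1 + z) W₁ = W₂ W₀`, `z = B₀ - B₁ + B₂` and
`z B₀ = z B₂ = B₂ B₀ = 0`, one has `W₂ (1 - B₂) · W₀ (1 - B₀) = W₁ (1 - B₁)`. [folklore] -/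
theorem cocycle_of_correction {W₀ W₁ W₂ z B₀ B₁ B₂ : K} (hc : (1 + z) * W₁ = W₂ * W₀)
    (hz : z = B₀ - B₁ + B₂) (hzB₀ : z * B₀ = 0) (hzB₂ : z * B₂ = 0) (hB : B₂ * B₀ = 0) :
    W₂ * (1 - B₂) * (W₀ * (1 - B₀)) = W₁ * (1 - B₁) := by
  have h1 : W₂ * (1 - B₂) * (W₀ * (1 - B₀)) = (W₂ * W₀) * (1 - B₂ - B₀ + B₂ * B₀) := by ring
  rw [h1, hB, add_zero, ← hc]
  have h2 : B₁ = B₀ + B₂ - z := by rw [hz]; ring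
  rw [h2]
  linear_combination (-W₁) * hzB₀ + (-W₁) * hzB₂

end Algebra

/-! ## Faces of quadruples as pairs -/

section QuadFaces

/-- Double restriction of a pair cochain equals the direct restriction along the composite
face map. [folklore] -/
theorem res_res_apply_eq_resOf (M : Type u) [AddCommGroup M] [Module R M] (c : CechObj y M 1)
    {n m : ℕ} (t : Fin n → Fin s) (θ : Fin m → Fin n) (θ' : Fin 2 → Fin m) (κ : Fin 2 → Fin n)
    (e : θ ∘ θ' = κ) :
    res y M t θ (res y M (t ∘ θ) θ' (c (t ∘ θ ∘ θ'))) =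
      resOf y M (t ∘ κ) t (dvd_comp y t κ) (c (t ∘ κ)) := by
  have h1 := congrArg (fun f => f (c (t ∘ θ ∘ θ'))) (res_comp y M t θ θ')
  simp only [LinearMap.coe_comp, Function.comp_apply] at h1
  rw [h1, res_eq_resOf' y M t (θ ∘ θ') (dvd_comp y t (θ ∘ θ'))]
  exact resOf_apply_congr c (show t ∘ (θ ∘ θ') = t ∘ κ by rw [e]) t _ _

/-- The twelve composites `δ_i ∘ δ_a : [1] → [3]`. [folklore] -/
theorem succAbove_comp_succAbove_fin_four :
    (Fin.succAbove (0 : Fin 4) ∘ Fin.succAbove (0 : Fin 3) = ![2, 3]) ∧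
    (Fin.succAbove (0 : Fin 4) ∘ Fin.succAbove (1 : Fin 3) = ![1, 3]) ∧
    (Fin.succAbove (0 : Fin 4) ∘ Fin.succAbove (2 : Fin 3) = ![1, 2]) ∧
    (Fin.succAbove (1 : Fin 4) ∘ Fin.succAbove (0 : Fin 3) = ![2, 3]) ∧
    (Fin.succAbove (1 : Fin 4) ∘ Fin.succAbove (1 : Fin 3) = ![0, 3]) ∧
    (Fin.succAbove (1 : Fin 4) ∘ Fin.succAbove (2 : Fin 3) = ![0, 2]) ∧
    (Fin.succAbove (2 : Fin 4) ∘ Fin.succAbove (0 : Fin 3) = ![1, 3]) ∧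
    (Fin.succAbove (2 : Fin 4) ∘ Fin.succAbove (1 : Fin 3) = ![0, 3]) ∧
    (Fin.succAbove (2 : Fin 4) ∘ Fin.succAbove (2 : Fin 3) = ![0, 1]) ∧
    (Fin.succAbove (3 : Fin 4) ∘ Fin.succAbove (0 : Fin 3) = ![1, 2]) ∧
    (Fin.succAbove (3 : Fin 4) ∘ Fin.succAbove (1 : Fin 3) = ![0, 2]) ∧
    (Fin.succAbove (3 : Fin 4) ∘ Fin.succAbove (2 : Fin 3) = ![0, 1]) := by
  refine ⟨?_, ?_, ?_, ?_, ?_, ?_, ?_, ?_, ?_, ?_, ?_, ?_⟩ <;> (funext k; fin_cases k <;> rfl)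

end QuadFaces

/-! ## The lifting theorem -/

section Lift

/-- **Unit `1`-cocycles lift through a square-zero extension when `Ȟ²` of the kernel vanishes**
(SGA 2 XI (1.1)–Prop. 1.1 in Čech form). Let `φ : A' → A` be a surjective `R`-algebra map with
`(ker φ)² = 0` such that every `2`-cocycle of `Č(y; ker φ)` (full ordered Čech complex, degree
`2` = quadruple test) is a coboundary. Then every family of units `u_{ij} ∈ A_{y_i y_j}` with
`u_{ij} u_{jk} = u_{ik}` lifts to such a family over `A'`.
[cite: Grothendieck1968SGA2, Exp. XI Prop. 1.1] -/
theorem exists_unit_cocycle_lift (hφ : Function.Surjective φ)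
    (hsq : ∀ a b : A', φ a = 0 → φ b = 0 → a * b = 0)
    (hH2 : ∀ z : CechObj y (LinearMap.ker φ.toLinearMap) 2, dC 2 z = 0 →
      ∃ b : CechObj y (LinearMap.ker φ.toLinearMap) 1, dC 1 b = z)
    (u : CechObj y A 1) (hunit : ∀ τ, IsUnit (u τ))
    (hcoc : ∀ σ : Fin 3 → Fin s,
      res y A σ (Fin.succAbove 2) (u (σ ∘ Fin.succAbove 2)) *
        res y A σ (Fin.succAbove 0) (u (σ ∘ Fin.succAbove 0)) =
      res y A σ (Fin.succAbove 1) (u (σ ∘ Fin.succAbove 1))) :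
    ∃ u' : CechObj y A' 1, (∀ τ, IsUnit (u' τ)) ∧
      (∀ σ : Fin 3 → Fin s,
        res y A' σ (Fin.succAbove 2) (u' (σ ∘ Fin.succAbove 2)) *
          res y A' σ (Fin.succAbove 0) (u' (σ ∘ Fin.succAbove 0)) =
        res y A' σ (Fin.succAbove 1) (u' (σ ∘ Fin.succAbove 1))) ∧
      cechObjMap y φ.toLinearMap 1 u' = u := by
  classical
  set ι := (LinearMap.ker φ.toLinearMap).subtype with hι
  have hιinj : Function.Injective ι := Subtype.val_injective
  -- Step 1: lift the units
  obtain ⟨w, hw⟩ := cechObjMap_surjective y φ.toLinearMap hφ 1 u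
  have hwτ : ∀ τ, locMap y φ.toLinearMap τ (w τ) = u τ := fun τ => by
    rw [← cechObjMap_apply, hw]
  have hwunit : ∀ τ, IsUnit (w τ) := fun τ =>
    isUnit_of_locMap_isUnit φ hφ hsq τ (by rw [hwτ]; exact hunit τ)
  -- face restrictions `W σ a` of `w` at a triple `σ`
  set W : ∀ (σ : Fin 3 → Fin s) (a : Fin 3), CechLoc y A' σ := fun σ a =>
    res y A' σ (Fin.succAbove a) (w (σ ∘ Fin.succAbove a)) with hW
  have hWunit : ∀ σ a, IsUnit (W σ a) := fun σ a => isUnit_res y A' σ _ (hwunit _)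
  have hWφ : ∀ σ a, locMap y φ.toLinearMap σ (W σ a) =
      res y A σ (Fin.succAbove a) (u (σ ∘ Fin.succAbove a)) := fun σ a => by
    rw [hW]; simp only; rw [locMap_res, hwτ]
  -- Step 2: the defect `E σ = W₂ W₀ - W₁` dies in `A`; `z σ := E σ · W₁⁻¹`
  have hE : ∀ σ, locMap y φ.toLinearMap σ (W σ 2 * W σ 0 - W σ 1) = 0 := fun σ => by
    rw [map_sub, locMap_mul, hWφ, hWφ, hWφ, hcoc σ, sub_self]
  set z : ∀ σ : Fin 3 → Fin s, CechLoc y A' σ := fun σ =>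
    ↑((hWunit σ 1).unit⁻¹) * (W σ 2 * W σ 0 - W σ 1) with hz
  have hzker : ∀ σ, locMap y φ.toLinearMap σ (z σ) = 0 := fun σ =>
    locMap_mul_eq_zero_of_locMap_eq_zero φ σ _ (hE σ)
  have hzrel : ∀ σ, (1 + z σ) * W σ 1 = W σ 2 * W σ 0 := fun σ => by
    rw [hz]; simp only
    have h1 : (↑((hWunit σ 1).unit⁻¹) : CechLoc y A' σ) * W σ 1 = 1 := (hWunit σ 1).val_inv_mul
    linear_combination (W σ 2 * W σ 0 - W σ 1) * h1
  -- Step 3: `z` is a `2`-cocycle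
  set zA : CechObj y A' 2 := fun σ => z σ with hzA
  have hres_zA_ker : ∀ (q : Fin 4 → Fin s) (i : Fin 4),
      locMap y φ.toLinearMap q (res y A' q (Fin.succAbove i) (zA (q ∘ Fin.succAbove i))) = 0 :=
    fun q i => locMap_res_eq_zero φ q _ (hzker _)
  -- restricted defect relations, in terms of the six edge units
  have hedge : ∀ (q : Fin 4 → Fin s) (i : Fin 4) (a : Fin 3) (κ : Fin 2 → Fin 4)
      (e : Fin.succAbove i ∘ Fin.succAbove a = κ),
      res y A' q (Fin.succAbove i) (W (q ∘ Fin.succAbove i) a) =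
        resOf y A' (q ∘ κ) q (dvd_comp y q κ) (w (q ∘ κ)) := fun q i a κ e => by
    rw [hW]; simp only
    exact res_res_apply_eq_resOf A' w q (Fin.succAbove i) (Fin.succAbove a) κ e
  have hface : ∀ (q : Fin 4 → Fin s) (i : Fin 4),
      (1 + res y A' q (Fin.succAbove i) (zA (q ∘ Fin.succAbove i))) *
        res y A' q (Fin.succAbove i) (W (q ∘ Fin.succAbove i) 1) =
      res y A' q (Fin.succAbove i) (W (q ∘ Fin.succAbove i) 2) *
        res y A' q (Fin.succAbove i) (W (q ∘ Fin.succAbove i) 0) := fun q i => by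
    have h := congrArg (res y A' q (Fin.succAbove i)) (hzrel (q ∘ Fin.succAbove i))
    rw [res_mul, res_mul, map_add, res_one] at h
    exact h
  have hdz : dC 2 zA = 0 := by
    funext q
    obtain ⟨e00, e01, e02, e10, e11, e12, e20, e21, e22, e30, e31, e32⟩ :=
      succAbove_comp_succAbove_fin_four
    have h0 := hface q 0
    have h1 := hface q 1
    have h2 := hface q 2
    have h3 := hface q 3
    rw [hedge q 0 1 _ e01, hedge q 0 2 _ e02, hedge q 0 0 _ e00] at h0
    rw [hedge q 1 1 _ e11, hedge q 1 2 _ e12, hedge q 1 0 _ e10] at h1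
    rw [hedge q 2 1 _ e21, hedge q 2 2 _ e22, hedge q 2 0 _ e20] at h2
    rw [hedge q 3 1 _ e31, hedge q 3 2 _ e32, hedge q 3 0 _ e30] at h3
    rw [dC_quadruple, Pi.zero_apply]
    exact alt_sum_eq_zero_of_defects (isUnit_resOf y A' _ _ _ (hwunit _))
      (isUnit_resOf y A' _ _ _ (hwunit _)) (isUnit_resOf y A' _ _ _ (hwunit _)) h0 h1 h2 h3
      (mul_eq_zero_of_locMap_eq_zero φ hsq q (hres_zA_ker q 0) (hres_zA_ker q 2))
      (mul_eq_zero_of_locMap_eq_zero φ hsq q (hres_zA_ker q 1) (hres_zA_ker q 3))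
  -- Step 4: `z = d b` with `b` in the kernel
  have hzcomp : ∀ σ, ∃ Z : CechLoc y (LinearMap.ker φ.toLinearMap) σ, locMap y ι σ Z = zA σ :=
    fun σ => exists_locMap_subtype_eq_of_locMap_eq_zero φ σ (hzker σ)
  choose zN hzN using hzcomp
  have hzN' : cechObjMap y ι 2 zN = zA := funext fun σ => by rw [cechObjMap_apply, hzN]
  have hdzN : dC 2 zN = 0 := by
    apply cechObjMap_injective y ι hιinj 3
    rw [← dC_cechObjMap, hzN', hdz, map_zero]
  obtain ⟨bN, hbN⟩ := hH2 zN hdzN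
  set bA : CechObj y A' 1 := cechObjMap y ι 1 bN with hbA
  have hbker : ∀ τ, locMap y φ.toLinearMap τ (bA τ) = 0 := fun τ => by
    rw [hbA, cechObjMap_apply]; exact locMap_locMap_subtype φ τ (bN τ)
  have hdb : dC 1 bA = zA := by rw [hbA, dC_cechObjMap, hbN, hzN']
  have hdbσ : ∀ σ : Fin 3 → Fin s, z σ =
      res y A' σ (Fin.succAbove 0) (bA (σ ∘ Fin.succAbove 0)) -
        res y A' σ (Fin.succAbove 1) (bA (σ ∘ Fin.succAbove 1)) +
        res y A' σ (Fin.succAbove 2) (bA (σ ∘ Fin.succAbove 2)) := fun σ => by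
    rw [← dC_triple, hdb]
  -- Step 5: the corrected lift
  refine ⟨fun τ => w τ * (1 - bA τ), fun τ =>
    (hwunit τ).mul (isUnit_one_sub_of_locMap_eq_zero φ hsq τ (hbker τ)), fun σ => ?_, ?_⟩
  · have hB : ∀ a : Fin 3,
        locMap y φ.toLinearMap σ (res y A' σ (Fin.succAbove a) (bA (σ ∘ Fin.succAbove a))) = 0 :=
      fun a => locMap_res_eq_zero φ σ _ (hbker _)
    rw [res_mul, res_mul, res_mul, map_sub, map_sub, map_sub, res_one, res_one, res_one]
    exact cocycle_of_correction (hzrel σ) (hdbσ σ)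
      (mul_eq_zero_of_locMap_eq_zero φ hsq σ (hzker σ) (hB 0))
      (mul_eq_zero_of_locMap_eq_zero φ hsq σ (hzker σ) (hB 2))
      (mul_eq_zero_of_locMap_eq_zero φ hsq σ (hB 2) (hB 0))
  · funext τ
    rw [cechObjMap_apply, locMap_mul, map_sub, locMap_one, hbker, sub_zero, mul_one, hwτ]

end Lift

end Literature.RingTheory.LocalCohomology

end
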